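import Mathlib
import HarnessLib
import Summits.Ventures.LatticeQCDFlow.Exactness.IMHCrossReplicaProposalExact

/-!
# A flow that proposes ONE BLOCK of the field conditioned on the frozen rest, corrected by the block's conditional weight, is exact for the
# FULL measure — only the block flow's density enters, never a global Jacobian (general state spaces, joint weight on a product reference)

HONEST FRAMING: exact (Metropolis-corrected) sampling algorithms for lattice gauge theory;
figures of merit are autocorrelation/cost numbers at stated couplings and volumes; no
continuum-physics claim.

Venture `LatticeQCDFlow` (cell pub-lqcd), topic `Exactness`; FANOUT row 30 (lean-1, GEN-42).  NEW WORK of the cell over Mathlib and the tree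
(`IMHKernel.indepMH_isReversible`; this generation's `IMHCrossReplicaProposalExact` for the set-wise form of the frozen lift
`L(x, y) = K(x, y) ⊗ δ_y`).  The tree's `FibreLift.freezeSnd_isReversible` states the lift for its own kernel constructor; here the same
mass-flow computation is done DEF-FREE (any Markov kernel with the displayed set function), for a JOINT weight `p` on a product reference
`μ ⊗ ν` — the lattice case: `X` = the links of one block (time-slice, sub-volume, single link), `Y` = the rest, `μ ⊗ ν` = product Haar,
`p = e^{−S}`.  `IMHCrossReplicaProposalExact` needed a PRODUCT target; interacting blocks need this file.

## Results (no `sorry`, no new definitions)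
* §1 **`blockUpdate_fst_setLIntegral_joint`** — the mass flow of the lift against `p·(μ ⊗ ν)` is the `ν(dy)`-integral of the FIBRE flows against
  `p(·, y)·μ` between the sections `A_y`, `B_y`; **`blockUpdate_fst_isReversible_joint`** — fibrewise detailed balance (each `K(·, y)` reversible
  for `p(·, y)·μ`) ⇒ the lift is reversible for `p·(μ ⊗ ν)`; **`blockUpdate_fst_invariant_joint`** — and leaves it invariant.
* §2 THE BLOCK FLOW SAMPLER: for every `y` a flow `q_y` on the block (any measurable family of probability laws) and the CONDITIONAL weight
  `w_y > 0` with `w_y·q_y = p(·, y)·μ` (i.e. `w_y = p(·, y)/q̃_y` when `q_y = q̃_y·μ`): `blockFlow_fibre_isReversible`,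
  **`blockFlow_isReversible`**, **`blockFlow_invariant`** — proposing the block from `q_y` and accepting with `min(1, w_y(x')/w_y(x))` while the
  rest stays frozen is in detailed balance with, and leaves invariant, the FULL weight `p·(μ ⊗ ν)` — for every block flow, every block, every
  action.  Sweeps over blocks compose (`Kernel.Invariant.comp`).
Reading (gauge files): a flow trained to generate the links of a sub-volume given its boundary, Metropolis-corrected with the LOCAL action
difference and the block flow's own density, updates the Wilson-type law exactly; the global trivializing map and its volume-sized Jacobian
are not needed for exactness — what the block size costs is acceptance, not correctness.  NOT CLAIMED: rates; anything about how the block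
flow is trained or how its acceptance scales with the block.
-/

noncomputable section

namespace Summit.Ventures.LatticeQCDFlow.Exactness

open MeasureTheory ProbabilityTheory
open scoped ENNReal

variable {X Y : Type*} [MeasurableSpace X] [MeasurableSpace Y]

/-! ## §1 The frozen lift against a joint weight: fibrewise detailed balance lifts -/

/-- **THE MASS FLOW OF THE LIFT, FIBREWISE**: for `L(x, y) = K(x, y) ⊗ δ_y` and the joint law `p·(μ ⊗ ν)`,
`∫_A L(z, B) d(p·(μ ⊗ ν)) = ∫ [∫_{A_y} K((x, y), B_y) (p(·, y)·μ)(dx)] ν(dy)` with sections `A_y = {x | (x, y) ∈ A}`. [ours — the def-free form of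
the tree's `FibreLift.setLIntegral_freezeSnd`] -/
theorem blockUpdate_fst_setLIntegral_joint (K : Kernel (X × Y) X) [IsMarkovKernel K] (μ : Measure X) [SFinite μ] (ν : Measure Y) [SFinite ν]
    {p : X × Y → ℝ≥0∞} (hp : Measurable p) (L : Kernel (X × Y) (X × Y)) (hL : ∀ z, L z = (K z).prod (Measure.dirac z.2))
    {A B : Set (X × Y)} (hA : MeasurableSet A) (hB : MeasurableSet B) :
    ∫⁻ z in A, L z B ∂((μ.prod ν).withDensity p) =
      ∫⁻ y, ∫⁻ x in (fun x => (x, y)) ⁻¹' A, K (x, y) ((fun x => (x, y)) ⁻¹' B) ∂(μ.withDensity fun x => p (x, y)) ∂ν := by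
  have hK : Measurable fun z => L z B := Kernel.measurable_coe _ hB
  rw [setLIntegral_withDensity_eq_setLIntegral_mul _ hp hK hA, ← lintegral_indicator hA,
    lintegral_prod_symm _ ((hp.mul hK).indicator hA).aemeasurable]
  refine lintegral_congr fun y => ?_
  have hAy : MeasurableSet ((fun x => (x, y)) ⁻¹' A) := measurable_prodMk_right hA
  have hKy : Measurable fun x => K (x, y) ((fun x => (x, y)) ⁻¹' B) :=
    (Kernel.measurable_coe K (measurable_prodMk_right hB)).comp measurable_prodMk_right
  rw [setLIntegral_withDensity_eq_setLIntegral_mul _ (show Measurable fun x => p (x, y) from hp.comp measurable_prodMk_right) hKy hAy,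
    ← lintegral_indicator hAy]
  refine lintegral_congr fun x => ?_
  by_cases hxy : (x, y) ∈ A
  · rw [Set.indicator_of_mem hxy, Set.indicator_of_mem (show x ∈ (fun x => (x, y)) ⁻¹' A from hxy), Pi.mul_apply, Pi.mul_apply,
      blockUpdate_fst_apply K L hL _ hB]
  · rw [Set.indicator_of_notMem hxy, Set.indicator_of_notMem (show x ∉ (fun x => (x, y)) ⁻¹' A from hxy)]

/-- **FIBREWISE DETAILED BALANCE LIFTS TO THE JOINT WEIGHT**: if for every frozen `y` the block kernel `K(·, y)` is in detailed balance with
`p(·, y)·μ`, then the lift `L = K ⊗ δ` is in detailed balance with `p·(μ ⊗ ν)`. [ours] -/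
theorem blockUpdate_fst_isReversible_joint (K : Kernel (X × Y) X) [IsMarkovKernel K] (μ : Measure X) [SFinite μ] (ν : Measure Y) [SFinite ν]
    {p : X × Y → ℝ≥0∞} (hp : Measurable p)
    (hfib : ∀ y, ∀ ⦃A' B' : Set X⦄, MeasurableSet A' → MeasurableSet B' →
      ∫⁻ x in A', K (x, y) B' ∂(μ.withDensity fun x => p (x, y)) = ∫⁻ x in B', K (x, y) A' ∂(μ.withDensity fun x => p (x, y)))
    (L : Kernel (X × Y) (X × Y)) (hL : ∀ z, L z = (K z).prod (Measure.dirac z.2)) :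
    Kernel.IsReversible L ((μ.prod ν).withDensity p) := by
  intro A B hA hB
  rw [blockUpdate_fst_setLIntegral_joint K μ ν hp L hL hA hB, blockUpdate_fst_setLIntegral_joint K μ ν hp L hL hB hA]
  refine lintegral_congr fun y => ?_
  exact hfib y (measurable_prodMk_right hA) (measurable_prodMk_right hB)

/-- … hence the joint weight is invariant under the lift. [ours] -/
theorem blockUpdate_fst_invariant_joint (K : Kernel (X × Y) X) [IsMarkovKernel K] (μ : Measure X) [SFinite μ] (ν : Measure Y) [SFinite ν]
    {p : X × Y → ℝ≥0∞} (hp : Measurable p)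
    (hfib : ∀ y, ∀ ⦃A' B' : Set X⦄, MeasurableSet A' → MeasurableSet B' →
      ∫⁻ x in A', K (x, y) B' ∂(μ.withDensity fun x => p (x, y)) = ∫⁻ x in B', K (x, y) A' ∂(μ.withDensity fun x => p (x, y)))
    (L : Kernel (X × Y) (X × Y)) (hL : ∀ z, L z = (K z).prod (Measure.dirac z.2)) :
    Kernel.Invariant L ((μ.prod ν).withDensity p) := by
  haveI : IsMarkovKernel L := ⟨fun z => by rw [hL z]; infer_instance⟩
  exact (blockUpdate_fst_isReversible_joint K μ ν hp hfib L hL).invariant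

/-! ## §2 The block flow sampler -/

variable {Ω : Type*} [MeasurableSpace Ω]

/-- Each fibre of the block flow sampler is in detailed balance with the conditional weight `p(·, y)·μ = w_y·q_y`. [ours — `IMHKernel`] -/
theorem blockFlow_fibre_isReversible (qfam : Y → Measure Ω) [∀ y, IsProbabilityMeasure (qfam y)] (wfam : Y → Ω → ℝ)
    (hw : ∀ y, Measurable (wfam y)) (hw0 : ∀ y x, 0 < wfam y x) (μ : Measure Ω) {p : Ω × Y → ℝ≥0∞}
    (hπ : ∀ y, (qfam y).withDensity (fun x => ENNReal.ofReal (wfam y x)) = μ.withDensity fun x => p (x, y))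
    (K : Kernel (Ω × Y) Ω) (hK : ∀ x y, K (x, y) = indepMH (qfam y) (wfam y) x) (y : Y) ⦃A' B' : Set Ω⦄
    (hA : MeasurableSet A') (hB : MeasurableSet B') :
    ∫⁻ x in A', K (x, y) B' ∂(μ.withDensity fun x => p (x, y)) = ∫⁻ x in B', K (x, y) A' ∂(μ.withDensity fun x => p (x, y)) := by
  simp_rw [hK, ← hπ y]
  exact indepMH_isReversible (hw y) (hw0 y) hA hB

/-- **THE BLOCK FLOW SAMPLER IS IN DETAILED BALANCE WITH THE FULL WEIGHT**: freeze `y`, propose the block `x' ∼ q_y` from a flow conditioned on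
`y`, accept with `min(1, w_y(x')/w_y(x))` where `w_y·q_y = p(·, y)·μ`; the lift is reversible for `p·(μ ⊗ ν)` — for EVERY block flow family,
every joint weight `p` and every reference `ν` on the rest. [ours] -/
theorem blockFlow_isReversible (qfam : Y → Measure Ω) [∀ y, IsProbabilityMeasure (qfam y)] (wfam : Y → Ω → ℝ)
    (hw : ∀ y, Measurable (wfam y)) (hw0 : ∀ y x, 0 < wfam y x) (μ : Measure Ω) [SFinite μ] (ν : Measure Y) [SFinite ν]
    {p : Ω × Y → ℝ≥0∞} (hp : Measurable p) (hπ : ∀ y, (qfam y).withDensity (fun x => ENNReal.ofReal (wfam y x)) = μ.withDensity fun x => p (x, y))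
    (K : Kernel (Ω × Y) Ω) [IsMarkovKernel K] (hK : ∀ x y, K (x, y) = indepMH (qfam y) (wfam y) x)
    (L : Kernel (Ω × Y) (Ω × Y)) (hL : ∀ z, L z = (K z).prod (Measure.dirac z.2)) :
    Kernel.IsReversible L ((μ.prod ν).withDensity p) :=
  blockUpdate_fst_isReversible_joint K μ ν hp (blockFlow_fibre_isReversible qfam wfam hw hw0 μ hπ K hK) L hL

/-- **… AND LEAVES IT INVARIANT**: the block flow update is exact for the full measure `p·(μ ⊗ ν)`. [ours] -/
theorem blockFlow_invariant (qfam : Y → Measure Ω) [∀ y, IsProbabilityMeasure (qfam y)] (wfam : Y → Ω → ℝ)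
    (hw : ∀ y, Measurable (wfam y)) (hw0 : ∀ y x, 0 < wfam y x) (μ : Measure Ω) [SFinite μ] (ν : Measure Y) [SFinite ν]
    {p : Ω × Y → ℝ≥0∞} (hp : Measurable p) (hπ : ∀ y, (qfam y).withDensity (fun x => ENNReal.ofReal (wfam y x)) = μ.withDensity fun x => p (x, y))
    (K : Kernel (Ω × Y) Ω) [IsMarkovKernel K] (hK : ∀ x y, K (x, y) = indepMH (qfam y) (wfam y) x)
    (L : Kernel (Ω × Y) (Ω × Y)) (hL : ∀ z, L z = (K z).prod (Measure.dirac z.2)) :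
    Kernel.Invariant L ((μ.prod ν).withDensity p) :=
  blockUpdate_fst_invariant_joint K μ ν hp (blockFlow_fibre_isReversible qfam wfam hw hw0 μ hπ K hK) L hL

end Summit.Ventures.LatticeQCDFlow.Exactness
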